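import Summits.ResolutionOfSingularities.ResolutionOfSingularities.Theorems.FrobeniusLadderFRationalResolutionMonomialMembershipDform
import HarnessLib

/-!
# Crux `FrobeniusLadder.FRationalResolution` (stmt-ResolutionOfSingularities-15317), line `redirect`,
# stub `stub_diagonalizableQuotientResolution` — **chart algebras over a log regular point: normal forms
# modulo the unit face, transfer of relations to the base, and EXISTENCE of the torus-fixed point**
# (point-blow-up recursion for the surface case over arbitrary fields, memo MEMO-15317-leafhand2-g6
# §3–§4: the ring-level substitute for brick P5 at the fixed points; part 1 of 2)

Generic log geometry in the tree's one-chart currency (`LogChart.IsLogRegularAt`, Kato 1994 Def. (2.1)),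
no gradings, no schemes. DATA: a chart `φ : P → A` (`P ⊆ ℤⁿ` finitely generated and saturated) on a
Noetherian ring `A`, a prime `𝔭` with unit face `F = F_𝔭` (`LogChart.faceMonoid`) and `L = ℤF`; and a
**chart algebra** over it: an `A`-algebra `C` GENERATED by a monoid homomorphism `χ : Q → C` extending `φ`
along `P ≤ Q ⊆ ℤⁿ` (`Algebra.adjoin A (range χ) = ⊤`) — the shape of every chart
`A[I/φ(a)] = A[χ(P_a)]` of a log blow-up (`LogChart.blowupChart`, `LogBlowupChart.lean`) and of its
iterates. HYPOTHESES, all satisfied by the blow-up charts at a Hilbert-basis element over a point whose face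
group lies in `Q`: (D) every `q ∈ Q` has `q + p ∈ P` for some `p ∈ P` (denominators); (K) the kernel of
`A → C` is killed by chart elements; (S) `Q ∩ L` is a face of `Q`; (H) `q + p ∈ L`, `q ∈ Q`, `p ∈ P`
forces `q ∈ L` (no element of `Q` off `L` becomes `≤ 0`).

RESULTS:

* `mem_span_range_of_adjoin_eq_top` — `C` is the `A`-span of `χ(Q)`; `mul_mem_span_of_face` — under (S)
  the `A`-span `N` of `χ(Q ∖ L)` is multiplicatively closed;
* `exists_val_mul_eq_add` — NORMAL FORM: every `x ∈ C` satisfies `φ(f)·x = a + y` with `f ∈ F`, `a ∈ A`,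
  `y ∈ N`; `exists_val_mul_eq_add_of_mem_span` — the same for the ideal `J = 𝔭C + χ(Q ∖ L)C`, with
  `a ∈ 𝔭`;
* `exists_finset_mul_eq_algebraMap_of_mem_span` — TRANSFER: for `y ∈ N`, `φ(p₀)·y` is the image of an
  element of the monomial ideal `(φ(w) : w ∈ W) ⊆ A` for a finite `W ⊆ p₀ + (Q ∖ L)`;
* **`comap_span_eq`** — `J ∩ A = 𝔭`: THE FIXED POINT EXISTS. Log regularity at `𝔭` enters (only) through
  the monomial-membership lemma `LogChart.exists_sub_sub_mem_span_faceMonoid_of_mem_span`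
  (`…MonomialMembershipDform`, Kato (6.1)-type): if `a₀ ∈ A ∖ 𝔭` lay in `J`, normal form and transfer
  would give `φ(p') ∈ (φ(w) : w − p' ∈ Q ∖ L)·A_𝔭`, so some `w − p' ≤ 0` modulo `L`, against (H).

Part 2 (`…ChartAlgebraFixedPoint`): the fixed prime, its uniqueness, unit face and maximal ideal.
Honest label: generic local algebra toward ONE leaf stub (no stub, crux or summit closed). No definitions,
no named facts, no sorry. [cite: Kato1994, Def. (2.1), (6.1), (10.1)] [cite: Niziol2006, §4]
-/

noncomputable section

-- single-problem summit: the doubled namespace component is forced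
set_option linter.dupNamespace false

open IsLocalRing Literature.AlgebraicGeometry.Resolution Literature.AlgebraicGeometry.Resolution.LogChart

namespace Summit.ResolutionOfSingularities.ResolutionOfSingularities.Theorems.FRationalResolution.ChartAlgebraNormalForm

universe u

variable {A : Type u} [CommRing A] {n : ℕ} {P : AddSubmonoid (Fin n → ℤ)} {φ : Multiplicative P →* A}
  {𝔭 : Ideal A} [𝔭.IsPrime] {C : Type u} [CommRing C] [Algebra A C] {Q : AddSubmonoid (Fin n → ℤ)}
  {χ : Multiplicative Q →* C}

/-! ### Bookkeeping for the chart `χ` -/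

/-- `χ` is additive-to-multiplicative on representatives. [folklore] -/
theorem chi_mk_add {v w : Fin n → ℤ} (hv : v ∈ Q) (hw : w ∈ Q) :
    χ (Multiplicative.ofAdd ⟨v + w, Q.add_mem hv hw⟩) =
      χ (Multiplicative.ofAdd ⟨v, hv⟩) * χ (Multiplicative.ofAdd ⟨w, hw⟩) := by
  rw [← map_mul, ← ofAdd_add]; rfl

/-- On `P` the chart `χ` is `φ` followed by `A → C` (restatement of the compatibility on members).
[folklore] -/
theorem chi_mk_eq_algebraMap_val (hPQ : P ≤ Q)
    (hχ : ∀ p : P, χ (Multiplicative.ofAdd ⟨(p : Fin n → ℤ), hPQ p.2⟩) =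
      algebraMap A C (φ (Multiplicative.ofAdd p)))
    {v : Fin n → ℤ} (hv : v ∈ P) :
    χ (Multiplicative.ofAdd ⟨v, hPQ hv⟩) = algebraMap A C (val P φ v) := by
  rw [val_of_mem P φ hv]; exact hχ ⟨v, hv⟩

/-- A generated chart algebra is the `A`-SPAN of the chart elements (the range of a monoid
homomorphism is multiplicatively closed). [folklore] -/
theorem mem_span_range_of_adjoin_eq_top (hgen : Algebra.adjoin A (Set.range χ) = ⊤) (x : C) :
    x ∈ Submodule.span A (Set.range (χ : Multiplicative Q → C)) := by
  have h1 : Submonoid.closure (Set.range (χ : Multiplicative Q → C)) = MonoidHom.mrange χ := by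
    rw [← MonoidHom.coe_mrange, Submonoid.closure_eq]
  have h2 : Subalgebra.toSubmodule (Algebra.adjoin A (Set.range (χ : Multiplicative Q → C))) =
      Submodule.span A (Set.range χ) := by
    rw [Algebra.adjoin_eq_span, h1, MonoidHom.coe_mrange]
  have hx : x ∈ Subalgebra.toSubmodule (Algebra.adjoin A (Set.range (χ : Multiplicative Q → C))) := by
    rw [hgen, Algebra.top_toSubmodule]; exact Submodule.mem_top
  rwa [h2] at hx

/-- The `A`-span `N` of `χ(Q ∖ L)` is closed under multiplication when `Q ∩ L` is a face of `Q`
(hypothesis (S)). [folklore] -/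
theorem mul_mem_span_of_face {L : Submodule ℤ (Fin n → ℤ)}
    (hS : ∀ q₁ ∈ Q, ∀ q₂ ∈ Q, q₁ + q₂ ∈ L → q₁ ∈ L) {y z : C}
    (hy : y ∈ Submodule.span A ((fun q : Q => χ (Multiplicative.ofAdd q)) '' {q : Q | (q : Fin n → ℤ) ∉ L}))
    (hz : z ∈ Submodule.span A ((fun q : Q => χ (Multiplicative.ofAdd q)) '' {q : Q | (q : Fin n → ℤ) ∉ L})) :
    y * z ∈ Submodule.span A ((fun q : Q => χ (Multiplicative.ofAdd q)) '' {q : Q | (q : Fin n → ℤ) ∉ L}) := by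
  have h := Submodule.mul_mem_mul hy hz
  rw [Submodule.span_mul_span] at h
  refine Submodule.span_mono ?_ h
  rintro _ ⟨_, ⟨q, hq, rfl⟩, _, ⟨q', -, rfl⟩, rfl⟩
  refine ⟨q + q', ?_, ?_⟩
  · intro hL
    exact hq (hS _ q.2 _ q'.2 (by simpa using hL))
  · change χ (Multiplicative.ofAdd (q + q')) = _
    rw [ofAdd_add, map_mul]

/-! ### Normal forms -/

/-- **Normal form of chart-algebra elements modulo the unit face.** For `C = A[χ(Q)]` with `χ`
extending `φ`: every `x ∈ C` satisfies `φ(f)·x = a + y` for some face element `f ∈ F_𝔭`, `a ∈ A` and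
`y` in the `A`-span of `χ(Q ∖ ℤF_𝔭)` (write `x = ∑ b_q χ(q)`; a chart element `χ(q)` with
`q = f₁ − f₂ ∈ ℤF_𝔭` becomes `φ(f₁)` after multiplication by `φ(f₂)`). [folklore] -/
theorem exists_val_mul_eq_add (hPQ : P ≤ Q)
    (hχ : ∀ p : P, χ (Multiplicative.ofAdd ⟨(p : Fin n → ℤ), hPQ p.2⟩) =
      algebraMap A C (φ (Multiplicative.ofAdd p)))
    (hgen : Algebra.adjoin A (Set.range χ) = ⊤) (x : C) :
    ∃ f ∈ faceMonoid P φ 𝔭, ∃ a : A, ∃ y ∈ Submodule.span A ((fun q : Q => χ (Multiplicative.ofAdd q)) ''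
        {q : Q | (q : Fin n → ℤ) ∉ Submodule.span ℤ (faceMonoid P φ 𝔭 : Set (Fin n → ℤ))}),
      algebraMap A C (val P φ f) * x = algebraMap A C a + y := by
  have hx := mem_span_range_of_adjoin_eq_top hgen x
  induction hx using Submodule.span_induction with
  | mem z hz =>
    obtain ⟨q, rfl⟩ := hz
    by_cases hq : ((Multiplicative.toAdd q : Q) : Fin n → ℤ) ∈
        Submodule.span ℤ (faceMonoid P φ 𝔭 : Set (Fin n → ℤ))
    · obtain ⟨f₁, hf₁, f₂, hf₂, h12⟩ := (mem_span_int_iff_exists_sub _).1 hq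
      refine ⟨f₂, hf₂, val P φ f₁, 0, Submodule.zero_mem _, ?_⟩
      rw [add_zero, ← chi_mk_eq_algebraMap_val hPQ hχ hf₂.1, ← chi_mk_eq_algebraMap_val hPQ hχ hf₁.1,
        ← map_mul]
      congr 1
      apply Multiplicative.toAdd.injective
      apply Subtype.ext
      change (f₂ : Fin n → ℤ) + ((Multiplicative.toAdd q : Q) : Fin n → ℤ) = f₁
      rw [h12]; abel
    · refine ⟨0, (faceMonoid P φ 𝔭).zero_mem, 0, χ q,
        Submodule.subset_span ⟨Multiplicative.toAdd q, hq, by simp⟩, ?_⟩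
      rw [val_zero, map_one, one_mul, map_zero, zero_add]
  | zero => exact ⟨0, (faceMonoid P φ 𝔭).zero_mem, 0, 0, Submodule.zero_mem _, by simp⟩
  | add x y _ _ hx hy =>
    obtain ⟨f, hf, a, z, hz, hxe⟩ := hx
    obtain ⟨g, hg, b, w, hw, hye⟩ := hy
    refine ⟨f + g, (faceMonoid P φ 𝔭).add_mem hf hg, val P φ g * a + val P φ f * b,
      val P φ g • z + val P φ f • w,
      Submodule.add_mem _ (Submodule.smul_mem _ _ hz) (Submodule.smul_mem _ _ hw), ?_⟩
    rw [val_add P φ hf.1 hg.1, map_mul, mul_add,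
      show algebraMap A C (val P φ f) * algebraMap A C (val P φ g) * x =
        algebraMap A C (val P φ g) * (algebraMap A C (val P φ f) * x) by ring, hxe,
      show algebraMap A C (val P φ f) * algebraMap A C (val P φ g) * y =
        algebraMap A C (val P φ f) * (algebraMap A C (val P φ g) * y) by ring, hye,
      map_add, map_mul, map_mul, Algebra.smul_def, Algebra.smul_def]
    ring
  | smul r x _ hx =>
    obtain ⟨f, hf, a, z, hz, hxe⟩ := hx
    refine ⟨f, hf, r * a, r • z, Submodule.smul_mem _ _ hz, ?_⟩
    rw [Algebra.smul_def, Algebra.smul_def, mul_left_comm, hxe, map_mul, mul_add]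

/-- **Normal form of the elements of `J = 𝔭C + χ(Q ∖ L)C`**: `φ(f)·x = π + y` with `π ∈ 𝔭` and `y`
in the `A`-span of `χ(Q ∖ L)` (needs (S): that span is multiplicatively closed). [folklore] -/
theorem exists_val_mul_eq_add_of_mem_span (hPQ : P ≤ Q)
    (hχ : ∀ p : P, χ (Multiplicative.ofAdd ⟨(p : Fin n → ℤ), hPQ p.2⟩) =
      algebraMap A C (φ (Multiplicative.ofAdd p)))
    (hgen : Algebra.adjoin A (Set.range χ) = ⊤)
    (hS : ∀ q₁ ∈ Q, ∀ q₂ ∈ Q, q₁ + q₂ ∈ Submodule.span ℤ (faceMonoid P φ 𝔭 : Set (Fin n → ℤ)) →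
      q₁ ∈ Submodule.span ℤ (faceMonoid P φ 𝔭 : Set (Fin n → ℤ)))
    {x : C} (hx : x ∈ Ideal.span ((algebraMap A C '' (𝔭 : Set A)) ∪
      ((fun q : Q => χ (Multiplicative.ofAdd q)) ''
        {q : Q | (q : Fin n → ℤ) ∉ Submodule.span ℤ (faceMonoid P φ 𝔭 : Set (Fin n → ℤ))}))) :
    ∃ f ∈ faceMonoid P φ 𝔭, ∃ π ∈ 𝔭, ∃ y ∈ Submodule.span A ((fun q : Q => χ (Multiplicative.ofAdd q)) ''
        {q : Q | (q : Fin n → ℤ) ∉ Submodule.span ℤ (faceMonoid P φ 𝔭 : Set (Fin n → ℤ))}),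
      algebraMap A C (val P φ f) * x = algebraMap A C π + y := by
  induction hx using Submodule.span_induction with
  | mem z hz =>
    rcases hz with ⟨π, hπ, rfl⟩ | ⟨q, hq, rfl⟩
    · exact ⟨0, (faceMonoid P φ 𝔭).zero_mem, π, hπ, 0, Submodule.zero_mem _, by
        rw [val_zero, map_one, one_mul, add_zero]⟩
    · exact ⟨0, (faceMonoid P φ 𝔭).zero_mem, 0, 𝔭.zero_mem, _, Submodule.subset_span ⟨q, hq, rfl⟩, by
        rw [val_zero, map_one, one_mul, map_zero, zero_add]⟩
  | zero => exact ⟨0, (faceMonoid P φ 𝔭).zero_mem, 0, 𝔭.zero_mem, 0, Submodule.zero_mem _, by simp⟩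
  | add x y _ _ hx hy =>
    obtain ⟨f, hf, a, ha, z, hz, hxe⟩ := hx
    obtain ⟨g, hg, b, hb, w, hw, hye⟩ := hy
    refine ⟨f + g, (faceMonoid P φ 𝔭).add_mem hf hg, val P φ g * a + val P φ f * b,
      𝔭.add_mem (𝔭.mul_mem_left _ ha) (𝔭.mul_mem_left _ hb), val P φ g • z + val P φ f • w,
      Submodule.add_mem _ (Submodule.smul_mem _ _ hz) (Submodule.smul_mem _ _ hw), ?_⟩
    rw [val_add P φ hf.1 hg.1, map_mul, mul_add,
      show algebraMap A C (val P φ f) * algebraMap A C (val P φ g) * x =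
        algebraMap A C (val P φ g) * (algebraMap A C (val P φ f) * x) by ring, hxe,
      show algebraMap A C (val P φ f) * algebraMap A C (val P φ g) * y =
        algebraMap A C (val P φ f) * (algebraMap A C (val P φ g) * y) by ring, hye,
      map_add, map_mul, map_mul, Algebra.smul_def, Algebra.smul_def]
    ring
  | smul c x _ hx =>
    obtain ⟨f, hf, π, hπ, y, hy, hxe⟩ := hx
    obtain ⟨g, hg, b, z, hz, hce⟩ := exists_val_mul_eq_add (𝔭 := 𝔭) hPQ hχ hgen c
    refine ⟨f + g, (faceMonoid P φ 𝔭).add_mem hf hg, b * π, 𝔭.mul_mem_left _ hπ,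
      b • y + π • z + z * y, Submodule.add_mem _ (Submodule.add_mem _ (Submodule.smul_mem _ _ hy)
        (Submodule.smul_mem _ _ hz)) (mul_mem_span_of_face hS hz hy), ?_⟩
    rw [val_add P φ hf.1 hg.1, map_mul, smul_eq_mul,
      show algebraMap A C (val P φ f) * algebraMap A C (val P φ g) * (c * x) =
        (algebraMap A C (val P φ g) * c) * (algebraMap A C (val P φ f) * x) by ring, hce, hxe,
      map_mul, Algebra.smul_def, Algebra.smul_def]
    ring

/-! ### Transfer of relations to the base -/

/-- Multiplying a monomial ideal `(φ(w) : w ∈ W)` of `A` by `φ(t)` lands in the monomial ideal of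
the translate `W + t`. [folklore] -/
theorem mul_mem_span_image_add {W : Finset P} {a : A}
    (ha : a ∈ Ideal.span ((fun w : P => φ (Multiplicative.ofAdd w)) '' (W : Set P))) (t : P) :
    φ (Multiplicative.ofAdd t) * a ∈
      Ideal.span ((fun w : P => φ (Multiplicative.ofAdd w)) '' ((W.image (· + t) : Finset P) : Set P)) := by
  classical
  induction ha using Submodule.span_induction with
  | mem z hz =>
    obtain ⟨w, hw, rfl⟩ := hz
    refine Ideal.subset_span ⟨w + t, Finset.mem_coe.2 (Finset.mem_image_of_mem _ (Finset.mem_coe.1 hw)), ?_⟩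
    change φ (Multiplicative.ofAdd (w + t)) = _
    rw [ofAdd_add, map_mul, mul_comm]
  | zero => rw [mul_zero]; exact Ideal.zero_mem _
  | add x y _ _ hx hy => rw [mul_add]; exact Ideal.add_mem _ hx hy
  | smul r x _ hx => rw [smul_eq_mul, mul_left_comm]; exact Ideal.mul_mem_left _ _ hx

/-- **Transfer.** Under (D), every `y` in the `A`-span of `χ(Q ∖ L)` satisfies
`φ(p₀)·y = (image of a)` for some `p₀ ∈ P` and some `a` in the monomial ideal `(φ(w) : w ∈ W)` of `A`,
`W ⊆ P` a finite set all of whose elements lie in `p₀ + (Q ∖ L)`. [folklore] -/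
theorem exists_finset_mul_eq_algebraMap_of_mem_span (hPQ : P ≤ Q)
    (hχ : ∀ p : P, χ (Multiplicative.ofAdd ⟨(p : Fin n → ℤ), hPQ p.2⟩) =
      algebraMap A C (φ (Multiplicative.ofAdd p)))
    (hD : ∀ q ∈ Q, ∃ p ∈ P, q + p ∈ P) {L : Submodule ℤ (Fin n → ℤ)} {y : C}
    (hy : y ∈ Submodule.span A ((fun q : Q => χ (Multiplicative.ofAdd q)) '' {q : Q | (q : Fin n → ℤ) ∉ L})) :
    ∃ (p₀ : P) (W : Finset P), (∀ w ∈ W, (w : Fin n → ℤ) - p₀ ∈ Q ∧ (w : Fin n → ℤ) - p₀ ∉ L) ∧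
      ∃ a ∈ Ideal.span ((fun w : P => φ (Multiplicative.ofAdd w)) '' (W : Set P)),
        algebraMap A C (φ (Multiplicative.ofAdd p₀)) * y = algebraMap A C a := by
  classical
  induction hy using Submodule.span_induction with
  | mem z hz =>
    obtain ⟨q, hq, rfl⟩ := hz
    obtain ⟨p, hp, hqp⟩ := hD _ q.2
    refine ⟨⟨p, hp⟩, {⟨(q : Fin n → ℤ) + p, hqp⟩}, ?_, φ (Multiplicative.ofAdd ⟨(q : Fin n → ℤ) + p, hqp⟩),
      Ideal.subset_span ⟨_, by simp, rfl⟩, ?_⟩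
    · intro w hw
      rw [Finset.mem_singleton] at hw
      subst hw
      have : ((⟨(q : Fin n → ℤ) + p, hqp⟩ : P) : Fin n → ℤ) - ((⟨p, hp⟩ : P) : Fin n → ℤ) = q := by
        simp
      rw [this]
      exact ⟨q.2, hq⟩
    · rw [← val_of_mem P φ hp, ← chi_mk_eq_algebraMap_val hPQ hχ hp, ← val_of_mem P φ hqp,
        ← chi_mk_eq_algebraMap_val hPQ hχ hqp, mul_comm, ← chi_mk_add q.2 (hPQ hp)]
  | zero =>
    exact ⟨0, ∅, by simp, 0, Ideal.zero_mem _, by rw [mul_zero, map_zero]⟩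
  | add x y _ _ hx hy =>
    obtain ⟨p₀, W, hW, a, ha, hxe⟩ := hx
    obtain ⟨p₁, W', hW', a', ha', hye⟩ := hy
    refine ⟨p₀ + p₁, W.image (· + p₁) ∪ W'.image (· + p₀), ?_,
      φ (Multiplicative.ofAdd p₁) * a + φ (Multiplicative.ofAdd p₀) * a', ?_, ?_⟩
    · intro w hw
      rcases Finset.mem_union.1 hw with hw | hw
      · obtain ⟨w₀, hw₀, rfl⟩ := Finset.mem_image.1 hw
        have : ((w₀ + p₁ : P) : Fin n → ℤ) - ↑(p₀ + p₁) = (w₀ : Fin n → ℤ) - p₀ := by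
          push_cast; abel
        rw [this]; exact hW w₀ hw₀
      · obtain ⟨w₀, hw₀, rfl⟩ := Finset.mem_image.1 hw
        have : ((w₀ + p₀ : P) : Fin n → ℤ) - ↑(p₀ + p₁) = (w₀ : Fin n → ℤ) - p₁ := by
          push_cast; abel
        rw [this]; exact hW' w₀ hw₀
    · refine Ideal.add_mem _ ?_ ?_
      · refine Ideal.span_mono ?_ (mul_mem_span_image_add ha p₁)
        refine Set.image_mono ?_
        intro w hw
        exact Finset.mem_union_left _ hw
      · refine Ideal.span_mono ?_ (mul_mem_span_image_add ha' p₀)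
        refine Set.image_mono ?_
        intro w hw
        exact Finset.mem_union_right _ hw
    · rw [ofAdd_add, map_mul, map_mul, mul_add,
        show algebraMap A C (φ (Multiplicative.ofAdd p₀)) * algebraMap A C (φ (Multiplicative.ofAdd p₁)) * x
          = algebraMap A C (φ (Multiplicative.ofAdd p₁)) * (algebraMap A C (φ (Multiplicative.ofAdd p₀)) * x)
          by ring, hxe,
        show algebraMap A C (φ (Multiplicative.ofAdd p₀)) * algebraMap A C (φ (Multiplicative.ofAdd p₁)) * y
          = algebraMap A C (φ (Multiplicative.ofAdd p₀)) * (algebraMap A C (φ (Multiplicative.ofAdd p₁)) * y)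
          by ring, hye, map_add, map_mul, map_mul]
  | smul r x _ hx =>
    obtain ⟨p₀, W, hW, a, ha, hxe⟩ := hx
    refine ⟨p₀, W, hW, r * a, Ideal.mul_mem_left _ _ ha, ?_⟩
    rw [Algebra.smul_def, mul_left_comm, hxe, map_mul]

/-! ### Existence of the fixed point: `J ∩ A = 𝔭` -/

/-- **The fixed point exists: `(𝔭C + χ(Q ∖ ℤF_𝔭)C) ∩ A = 𝔭`.** For a chart `φ : P → A` (finitely
generated saturated `P ⊆ ℤⁿ`, `A` Noetherian) LOG REGULAR AT `𝔭`, and a chart algebra `C = A[χ(Q)]`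
satisfying (D), (K), (S), (H): if `a₀ ∈ A ∖ 𝔭` lay in `J`, the normal form and the transfer would give
a monomial relation `φ(p') ∈ (φ(w) : w ∈ p' + p₀⁻¹W)·A_𝔭` with all `w − p'` in `Q ∖ ℤF_𝔭`; by monomial
membership in the log regular ring `A_𝔭` (`LogChart.exists_sub_sub_mem_span_faceMonoid_of_mem_span`)
some `w − p' ≤ 0` modulo `ℤF_𝔭`, contradicting (H). [cite: Kato1994, (6.1), (10.1)] -/
theorem comap_span_eq [IsNoetherianRing A] (hP : P.FG)
    (hsat : ∀ (v : Fin n → ℤ) (k : ℕ), 0 < k → k • v ∈ P → v ∈ P) (hreg : IsLogRegularAt P φ 𝔭)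
    (hPQ : P ≤ Q)
    (hχ : ∀ p : P, χ (Multiplicative.ofAdd ⟨(p : Fin n → ℤ), hPQ p.2⟩) =
      algebraMap A C (φ (Multiplicative.ofAdd p)))
    (hgen : Algebra.adjoin A (Set.range χ) = ⊤)
    (hD : ∀ q ∈ Q, ∃ p ∈ P, q + p ∈ P)
    (hK : ∀ a : A, algebraMap A C a = 0 → ∃ p : P, φ (Multiplicative.ofAdd p) * a = 0)
    (hS : ∀ q₁ ∈ Q, ∀ q₂ ∈ Q, q₁ + q₂ ∈ Submodule.span ℤ (faceMonoid P φ 𝔭 : Set (Fin n → ℤ)) →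
      q₁ ∈ Submodule.span ℤ (faceMonoid P φ 𝔭 : Set (Fin n → ℤ)))
    (hH : ∀ q ∈ Q, ∀ p ∈ P, q + p ∈ Submodule.span ℤ (faceMonoid P φ 𝔭 : Set (Fin n → ℤ)) →
      q ∈ Submodule.span ℤ (faceMonoid P φ 𝔭 : Set (Fin n → ℤ))) :
    (Ideal.span ((algebraMap A C '' (𝔭 : Set A)) ∪
      ((fun q : Q => χ (Multiplicative.ofAdd q)) ''
        {q : Q | (q : Fin n → ℤ) ∉ Submodule.span ℤ (faceMonoid P φ 𝔭 : Set (Fin n → ℤ))}))).comap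
      (algebraMap A C) = 𝔭 := by
  classical
  refine le_antisymm ?_ ?_
  swap
  · intro b hb
    rw [Ideal.mem_comap]
    exact Ideal.subset_span (Or.inl ⟨b, hb, rfl⟩)
  intro a₀ ha₀
  rw [Ideal.mem_comap] at ha₀
  by_contra ha₀𝔭
  obtain ⟨f, hf, π, hπ, y, hy, hEq⟩ := exists_val_mul_eq_add_of_mem_span hPQ hχ hgen hS ha₀
  -- `a₁ = φ(f) a₀ − π ∉ 𝔭` maps to `y ∈ N`
  set a₁ : A := val P φ f * a₀ - π with ha₁def
  have ha₁𝔭 : a₁ ∉ 𝔭 := by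
    intro h
    have h2 : val P φ f * a₀ ∈ 𝔭 := by simpa [ha₁def] using 𝔭.add_mem h hπ
    exact (Ideal.IsPrime.mem_or_mem ‹_› h2).elim hf.2 ha₀𝔭
  have ha₁y : algebraMap A C a₁ = y := by
    rw [ha₁def, map_sub, map_mul, hEq, add_sub_cancel_left]
  obtain ⟨p₀, W, hW, a, ha, hye⟩ := exists_finset_mul_eq_algebraMap_of_mem_span hPQ hχ hD hy
  -- pull the relation back to `A` with (K)
  have hzero : algebraMap A C (φ (Multiplicative.ofAdd p₀) * a₁ - a) = 0 := by
    rw [map_sub, map_mul, ha₁y, hye, sub_self]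
  obtain ⟨p, hp⟩ := hK _ hzero
  have hrel : φ (Multiplicative.ofAdd (p + p₀)) * a₁ = φ (Multiplicative.ofAdd p) * a := by
    have h1 : φ (Multiplicative.ofAdd p) * (φ (Multiplicative.ofAdd p₀) * a₁) -
        φ (Multiplicative.ofAdd p) * a = 0 := by rw [← mul_sub]; exact hp
    rw [ofAdd_add, map_mul, mul_assoc]
    exact sub_eq_zero.1 h1
  have hmem : φ (Multiplicative.ofAdd (p + p₀)) * a₁ ∈
      Ideal.span ((fun w : P => φ (Multiplicative.ofAdd w)) '' ((W.image (· + p) : Finset P) : Set P)) := by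
    rw [hrel]; exact mul_mem_span_image_add ha p
  -- in `A_𝔭`, `a₁` is a unit
  have hu : IsUnit (algebraMap A (Localization.AtPrime 𝔭) a₁) :=
    IsLocalization.map_units (Localization.AtPrime 𝔭) (⟨a₁, ha₁𝔭⟩ : 𝔭.primeCompl)
  have hloc : algebraMap A (Localization.AtPrime 𝔭) (φ (Multiplicative.ofAdd (p + p₀))) ∈
      Ideal.span ((fun q : P => algebraMap A (Localization.AtPrime 𝔭) (φ (Multiplicative.ofAdd q))) ''
        ((W.image (· + p) : Finset P) : Set P)) := by
    have h1 := Ideal.mem_map_of_mem (algebraMap A (Localization.AtPrime 𝔭)) hmem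
    rw [Ideal.map_span, ← Set.image_comp, map_mul] at h1
    have h2 := Ideal.mul_mem_right (↑hu.unit⁻¹ : Localization.AtPrime 𝔭) _ h1
    rwa [mul_assoc, IsUnit.mul_val_inv, mul_one] at h2
  haveI : IsNoetherianRing A := inferInstance
  obtain ⟨w', hw', s, hs⟩ :=
    exists_sub_sub_mem_span_faceMonoid_of_mem_span hP hsat hreg (p + p₀) (W.image (· + p)) hloc
  obtain ⟨w, hw, rfl⟩ := Finset.mem_image.1 hw'
  obtain ⟨hwQ, hwL⟩ := hW w hw
  apply hwL
  refine hH _ hwQ _ s.2 ?_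
  have : ((p + p₀ : P) : Fin n → ℤ) - ↑(w + p) - ↑s = -(((w : Fin n → ℤ) - p₀) + s) := by
    push_cast; abel
  rw [this, Submodule.neg_mem_iff] at hs
  exact hs

end Summit.ResolutionOfSingularities.ResolutionOfSingularities.Theorems.FRationalResolution.ChartAlgebraNormalForm

end
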